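import Literature.Geometry.Riemannian.BishopGromovDirectional
import Literature.Geometry.Riemannian.ExpMapThm1034
import Literature.Geometry.Riemannian.CutLocusGeodesic
import Literature.Geometry.Riemannian.DistanceSmoothOffCutLocus
import HarnessLib

/-!
# The cut locus is a null set

On a connected complete Riemannian manifold the cut locus `Cut(p)` of every point has
Riemannian measure zero (Chavel 2006, §III.3, proof of (III.3.5): the volume is computed in polar
coordinates on the domain `D_p = exp_p(ID(p)) = M ∖ Cut(p)`, "`Cut(p)` has measure zero";
Lee 2018, Thm. 10.34 (a)). We PROVE it (`riemannianMeasure_geodesicCutLocus_eq_zero`,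
`riemannianMeasure_cutLocus_eq_zero`) from the tree's polar representation `expPolar_data`
(every point is `exp_p(L x)` with `L x ∈ ID(p)` or `x` in a Lebesgue-null set `N` whose image is
null) and `exp_p(ID(p)) = Cut(p)ᶜ` (`lee_expMap_injectivityDomain_holds`, Lee 2018, Thm. 10.34).
Consequently (`ae_laplaceBeltrami_edist_le_coth`, `ae_laplaceBeltrami_edist_le_div`) the distance
function is smooth with `Δ d(q,·) ≤ (d-1) coth d(q,·)` (resp. `≤ (d-1)/d(q,·)`) at `Vol_g`-almost
every point (`DistanceSmoothOffCutLocus.lean`). No definitions, no named facts (D-0026).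
Groundwork for `CheegerColding1997_sphereStability`.

## References

* I. Chavel, *Riemannian Geometry: A Modern Introduction*, 2nd ed. (2006), §III.3. [Chavel2006]
* J. M. Lee, *Introduction to Riemannian Manifolds*, 2nd ed. (2018), Thm. 10.34. [LeeRiemannianManifolds2018]
-/

noncomputable section

open Bundle Set Function Filter MeasureTheory Manifold
open scoped Manifold ContDiff Topology ENNReal NNReal

namespace Literature.Geometry.Riemannian

open Lorentzian Lorentzian.PseudoRiemannianMetric

variable {d : ℕ} {M : Type*} [TopologicalSpace M] [ChartedSpace (EuclideanSpace ℝ (Fin d)) M]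
  [IsManifold 𝓘(ℝ, EuclideanSpace ℝ (Fin d)) ∞ M] [T2Space M]
  (g : PseudoRiemannianMetric 𝓘(ℝ, EuclideanSpace ℝ (Fin d)) ∞ (EuclideanSpace ℝ (Fin d))
    (TangentSpace 𝓘(ℝ, EuclideanSpace ℝ (Fin d)) : M → Type _)) [g.HasLeviCivita]
  [CovariantDerivative.ContMDiffCovariantDerivative g.leviCivita 1]
  [CovariantDerivative.ContMDiffCovariantDerivative g.leviCivita ∞]

/-- **The (geodesic) cut locus is null** (Chavel 2006, §III.3: "`Cut(p)` has measure zero";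
Lee 2018, Thm. 10.34): on a connected Riemannian `d`-manifold (`d > 0`) with complete Levi-Civita
connection, `Vol_g (Cut(p)) = 0` for the cut locus `exp_p(TCL(p))`.
[cite: Chavel2006, §III.3, (III.3.5)] [cite: LeeRiemannianManifolds2018, Thm. 10.34] -/
theorem riemannianMeasure_geodesicCutLocus_eq_zero (hd : 0 < d) [ConnectedSpace M]
    [T3Space M] [MeasurableSpace M] [BorelSpace M] (hg : g.IsRiemannian)
    (hc : IsGeodesicallyComplete g.leviCivita) (p : M) :
    riemannianMeasure (I := 𝓘(ℝ, (EuclideanSpace ℝ (Fin d)))) (g.toContMDiffRiemannianMetric hg)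
        (geodesicCutLocus g hg p) = 0 := by
  classical
  haveI : Nontrivial (EuclideanSpace ℝ (Fin d)) := by
    have : 0 < Module.finrank ℝ (EuclideanSpace ℝ (Fin d)) := by
      rw [finrank_euclideanSpace_fin]; exact hd
    exact Module.finrank_pos_iff.1 this
  obtain ⟨L, hL⟩ := exists_linearIsometry_tangentSpace g hg p
  obtain ⟨-, -, ⟨N, -, -, hΦN, hpolar⟩, -⟩ := expPolar_data g hd hg hc p L hL
  -- `exp_p(ID(p)) = Cut(p)ᶜ`
  obtain ⟨-, -, himage, -, -⟩ := lee_expMap_injectivityDomain_holds le_rfl g hg hc p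
  refine measure_mono_null (fun y hy ↦ ?_) hΦN
  obtain ⟨x, hxy, -, -, hxWN⟩ := hpolar y
  rcases hxWN with hxW | hxN
  · -- `y = exp_p(L x)` with `L x ∈ ID(p)` is not a cut point
    have hy' : y ∈ riemannianExpMap g p '' injectivityDomain g hg p :=
      ⟨(show TangentSpace 𝓘(ℝ, (EuclideanSpace ℝ (Fin d))) p from L x), hxW, hxy⟩
    rw [himage] at hy'
    exact absurd hy hy'
  · exact ⟨x, hxN, hxy⟩

/-- **The metric cut locus is null**: `Vol_g (cutLocus p) = 0` (the metric cut locus of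
`CutLocus.lean` equals the geodesic one, `cutLocus_eq_geodesicCutLocus`).
[cite: Chavel2006, §III.3, (III.3.5)] [cite: LeeRiemannianManifolds2018, Thm. 10.34] -/
theorem riemannianMeasure_cutLocus_eq_zero (hd : 0 < d) [ConnectedSpace M]
    [T3Space M] [MeasurableSpace M] [BorelSpace M] (hg : g.IsRiemannian)
    (hc : IsGeodesicallyComplete g.leviCivita) (p : M) :
    riemannianMeasure (I := 𝓘(ℝ, (EuclideanSpace ℝ (Fin d)))) (g.toContMDiffRiemannianMetric hg)
        (cutLocus g hg p) = 0 := by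
  rw [cutLocus_eq_geodesicCutLocus le_rfl hg hc p]
  exact riemannianMeasure_geodesicCutLocus_eq_zero g hd hg hc p

/-- **Almost every point is not a cut point of `p`**, for the Riemannian measure. [folklore] -/
theorem ae_not_mem_cutLocus (hd : 0 < d) [ConnectedSpace M]
    [T3Space M] [MeasurableSpace M] [BorelSpace M] (hg : g.IsRiemannian)
    (hc : IsGeodesicallyComplete g.leviCivita) (p : M) :
    ∀ᵐ y ∂(riemannianMeasure (I := 𝓘(ℝ, (EuclideanSpace ℝ (Fin d))))
      (g.toContMDiffRiemannianMetric hg)), y ∉ cutLocus g hg p := by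
  rw [ae_iff]
  simpa using riemannianMeasure_cutLocus_eq_zero g hd hg hc p

/-! ### Almost-everywhere Laplacian comparison for the distance function -/

section AEComparison

variable {d : ℕ} {M : Type*} [TopologicalSpace M] [ChartedSpace (EuclideanSpace ℝ (Fin d)) M]
  [IsManifold 𝓘(ℝ, EuclideanSpace ℝ (Fin d)) ∞ M] [T2Space M]
  (g : PseudoRiemannianMetric 𝓘(ℝ, EuclideanSpace ℝ (Fin d)) ∞ (EuclideanSpace ℝ (Fin d))
    (TangentSpace 𝓘(ℝ, EuclideanSpace ℝ (Fin d)) : M → Type _)) [g.HasLeviCivita]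
  [CovariantDerivative.ContMDiffCovariantDerivative g.leviCivita 1]
  [CovariantDerivative.ContMDiffCovariantDerivative g.leviCivita ∞]

omit [CovariantDerivative.ContMDiffCovariantDerivative g.leviCivita ∞] in
/-- Off `{q} ∪ Cut(q)` a point is `exp_q w` with `w ∈ ID(q) ∖ {0}` (`exp_q(ID(q)) = Cut(q)ᶜ`,
Lee 2018, Thm. 10.34). [cite: LeeRiemannianManifolds2018, Thm. 10.34] -/
theorem exists_mem_injectivityDomain_of_not_mem_cutLocus [ConnectedSpace M] (hg : g.IsRiemannian)
    (hc : IsGeodesicallyComplete g.leviCivita) {q z : M} (hz : z ∉ cutLocus g hg q) (hzq : z ≠ q) :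
    ∃ w : TangentSpace 𝓘(ℝ, EuclideanSpace ℝ (Fin d)) q, w ∈ injectivityDomain g hg q ∧ w ≠ 0 ∧
      expMap g.leviCivita q w = z := by
  obtain ⟨-, -, himg, -, -⟩ := lee_expMap_injectivityDomain_holds le_rfl g hg hc q
  rw [cutLocus_eq_geodesicCutLocus le_rfl hg hc q] at hz
  have hz' : z ∈ (geodesicCutLocus g hg q)ᶜ := hz
  rw [← himg] at hz'
  obtain ⟨w, hw, rfl⟩ := hz'
  refine ⟨w, hw, ?_, rfl⟩
  rintro rfl
  exact hzq (expMap_zero (cov := g.leviCivita) q)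

/-- **Laplacian comparison almost everywhere, `Ric ≥ -(d-1)`** (Chavel 2006, Thm. III.4.3 with
§III.3: the distance function is smooth off the null set `{q} ∪ Cut(q)`, where
`Δ d(q, ·) ≤ (d-1) coth d(q, ·)`): for `Vol_g`-a.e. `z`, if `z ≠ q` then `d(q, ·)` is `C^∞` at
`z` and `Δ_g d(q, ·)(z) ≤ (d-1) coth d(q, z)`.
[cite: Chavel2006, Thm. III.4.3, §III.3] [cite: LeeRiemannianManifolds2018, Thm. 10.34, Thm. 11.15] -/
theorem ae_laplaceBeltrami_edist_le_coth (hd : 0 < d) [ConnectedSpace M]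
    [T3Space M] [MeasurableSpace M] [BorelSpace M] (hg : g.IsRiemannian)
    (hc : IsGeodesicallyComplete g.leviCivita)
    (hRic : ∀ (x : M) (w : TangentSpace 𝓘(ℝ, EuclideanSpace ℝ (Fin d)) x),
      -((Module.finrank ℝ (EuclideanSpace ℝ (Fin d)) : ℝ) - 1) * g.val x w w ≤
        g.leviCivita.ricci x w w) (q : M) :
    ∀ᵐ z ∂(riemannianMeasure (I := 𝓘(ℝ, (EuclideanSpace ℝ (Fin d))))
      (g.toContMDiffRiemannianMetric hg)), z ≠ q →
        ContMDiffAt 𝓘(ℝ, EuclideanSpace ℝ (Fin d)) 𝓘(ℝ, ℝ) ∞ (fun z' ↦ (g.edist hg q z').toReal) z ∧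
          g.laplaceBeltrami (fun z' ↦ (g.edist hg q z').toReal) z ≤
            ((Module.finrank ℝ (EuclideanSpace ℝ (Fin d)) : ℝ) - 1) *
              (Real.cosh (g.edist hg q z).toReal / Real.sinh (g.edist hg q z).toReal) := by
  filter_upwards [ae_not_mem_cutLocus g hd hg hc q] with z hz hzq
  obtain ⟨w, hw, hw0, rfl⟩ := exists_mem_injectivityDomain_of_not_mem_cutLocus g hg hc hz hzq
  exact ⟨contMDiffAt_edist_toReal_of_mem_injectivityDomain g hg hc q hw hw0,
    laplaceBeltrami_edist_le_coth_of_mem_injectivityDomain g hg hc hRic q hw hw0⟩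

/-- **Laplacian comparison almost everywhere, `Ric ≥ 0`**: for `Vol_g`-a.e. `z ≠ q`, `d(q, ·)`
is `C^∞` at `z` and `Δ_g d(q, ·)(z) ≤ (d-1)/d(q, z)`.
[cite: Chavel2006, Thm. III.4.3, §III.3] [cite: Zhu1997ComparisonRicci, Lemma 4.13] -/
theorem ae_laplaceBeltrami_edist_le_div (hd : 0 < d) [ConnectedSpace M]
    [T3Space M] [MeasurableSpace M] [BorelSpace M] (hg : g.IsRiemannian)
    (hc : IsGeodesicallyComplete g.leviCivita)
    (hRic : ∀ (x : M) (w : TangentSpace 𝓘(ℝ, EuclideanSpace ℝ (Fin d)) x),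
      0 ≤ g.leviCivita.ricci x w w) (q : M) :
    ∀ᵐ z ∂(riemannianMeasure (I := 𝓘(ℝ, (EuclideanSpace ℝ (Fin d))))
      (g.toContMDiffRiemannianMetric hg)), z ≠ q →
        ContMDiffAt 𝓘(ℝ, EuclideanSpace ℝ (Fin d)) 𝓘(ℝ, ℝ) ∞ (fun z' ↦ (g.edist hg q z').toReal) z ∧
          g.laplaceBeltrami (fun z' ↦ (g.edist hg q z').toReal) z ≤
            ((Module.finrank ℝ (EuclideanSpace ℝ (Fin d)) : ℝ) - 1) * (1 / (g.edist hg q z).toReal) := by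
  filter_upwards [ae_not_mem_cutLocus g hd hg hc q] with z hz hzq
  obtain ⟨w, hw, hw0, rfl⟩ := exists_mem_injectivityDomain_of_not_mem_cutLocus g hg hc hz hzq
  exact ⟨contMDiffAt_edist_toReal_of_mem_injectivityDomain g hg hc q hw hw0,
    laplaceBeltrami_edist_le_div_of_mem_injectivityDomain g hg hc hRic q hw hw0⟩

end AEComparison

end Literature.Geometry.Riemannian

end
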